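import Summits.ValiantsHypothesis.ValiantsHypothesis.Theorems.KPlusLogSqLawTropicalBToeplitzNine

/-!
# Route `KPlusLogSqLaw`, crux `TropicalB` — Conjecture T: the linear form with constant `3` is refuted in the kernel

HONEST FRAMING.  Helper toward the registered stubs `stub_tropThin` / `stub_tropFat` of
`Cruxes/TropicalB/Lines/birth.lean` (crux `Summit.ValiantsHypothesis.ValiantsHypothesis.Theses.KPlusLogSqLaw.TropicalB`,
ledger item `stmt-ValiantsHypothesis-19771`, route `KPlusLogSqLaw`; cell `pub-symmetroid`, seat `val-sym-trop-p3`,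
2026-08-26).  A one-line consequence of the kernel certificate `toeplitz_nine_chain_28` (`…ToeplitzNine`): the cell's
Conjecture T in the LINEAR form «every linear Toeplitz instance of size `m` has at most `c·m` pairwise distinct unique optima
along increasing integer slopes» is FALSE for `c = 3` (`28 > 27` at `m = 9`); the linear form with `c ≥ 4` and the
polynomial form are untouched (data: `18, 23, 26, 28, ≥ 26` at `m = 6, …, 10`).  Nothing here bears on `TropicalB` for
general designs, `KPlusLogSqLaw`, `MatrixDescartes` or `VP ≠ VNP`.

* `not_toeplitz_linearBound_three_mul` — there is no bound of the shape of `toeplitz_chain_le_of_linearBound`'s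
  hypothesis that is `≤ 3·m` at every size `m` (stated without any definition: the hypothesis shape is inlined, with the
  size universally quantified).

References: `toeplitz_linearBound_nine_ge` (`…ToeplitzNine`, kernel certificate from kit job j252457's instance `9_120`).
-/

set_option linter.dupNamespace false
set_option autoImplicit false

namespace Summit.ValiantsHypothesis.ValiantsHypothesis.Theorems.KPlusLogSqLaw

open scoped BigOperators
open Finset

section Calibration

/-- **Conjecture T with constant `3` is false.**  It is NOT the case that for every size `m` the number of pairwise
distinct unique optima of every linear Toeplitz instance along strictly increasing integer slopes is at most `3·m`: at
`m = 9` the certified chain of `toeplitz_nine_chain_28` has `28 > 27` members (`toeplitz_linearBound_nine_ge`).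
[folklore] -/
theorem not_toeplitz_linearBound_three_mul :
    ¬ (∀ (m : ℕ) (ψ α : ℤ → ℤ) (P : ℤ → Prop) (N : ℕ) (θ' : Fin (N + 1) → ℤ)
        (τ : Fin (N + 1) → Equiv.Perm (Fin m)),
      StrictMono θ' → Function.Injective τ → (∀ k b, P ((τ k b : ℤ) - (b : ℤ))) →
      (∀ k (σ' : Equiv.Perm (Fin m)), σ' ≠ τ k → (∀ b, P ((σ' b : ℤ) - (b : ℤ))) →
        ∑ b, (θ' k * ψ ((σ' b : ℤ) - (b : ℤ)) + α ((σ' b : ℤ) - (b : ℤ))) <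
          ∑ b, (θ' k * ψ ((τ k b : ℤ) - (b : ℤ)) + α ((τ k b : ℤ) - (b : ℤ)))) →
      N + 1 ≤ 3 * m) := by
  intro h
  have h9 := toeplitz_linearBound_nine_ge (3 * 9) (fun ψ α P N θ' τ hθ hτ hP hu => h 9 ψ α P N θ' τ hθ hτ hP hu)
  omega

end Calibration

end Summit.ValiantsHypothesis.ValiantsHypothesis.Theorems.KPlusLogSqLaw
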